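import Summits.CriticalPhenomena.CardyFormulaZ2.Theorems.HalfPlaneMarkDensityLaw.Negative.MarkEvents
import Literature.Probability.Percolation.KSTPeriodicSymmetry
import Literature.Probability.Percolation.PlanarDuality
import Literature.Probability.Percolation.Z2HalfPlaneTwoArm

/-!
# Line `Sketch`, self-duality programme, Stage II: the deterministic cover `fewL_cover`
# (crux stmt-CriticalPhenomena-5661, lead c3-0)

Bottom-row insensitivity of half-plane crossing probabilities of bond-`ℤ²`, `H = ℤ × ℕ`.
The "few touches on the ray window" event `FewL` of the thinning inequality (`legs_thinning`):
`r` is the least point of `[1,S] × {0}` joined inside `H` to the ray `I = (-∞,-X] × {0}`, and the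
`H`-cluster of `(r, 0)` touches the ray window `[-X-W, -X] × {0}` in at most `M` points.  This purely
deterministic lemma covers `FewL` by four events:
* (F) the arc `[1,S] × {0}` is joined in `H` to the far ray `{v₀ < -X-W} × {0}`;
* (E1) the short arc `[-X-W, -X-W+ℓ] × {0}` is joined in `H` to `[1,S] × {0}`;
* (E2) the short arc `[-X-ℓ, -X] × {0}` is joined in `H` to `[1,S] × {0}`;
* (B) bulk: some `t ∈ [-X-W+ℓ, -X-ℓ]` with `(t,0)` joined in `H` to `[1,S] × {0}`, all window touches
  `u` of its `H`-cluster in `[-X-W+ℓ, -X-ℓ]`, and at most `M` of them.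

Proof: the witness `x ∈ I` of the crossing to `(r,0)` either lies on the far ray (event (F)), or is a
window touch `(a, 0)`; if some window touch `u` of the cluster of `(r,0)` lies in one of the two end
zones we are in (E1) resp. (E2), and otherwise `t := a` witnesses (B), since the window touches of the
clusters of `(a,0)` and `(r,0)` coincide (transitivity of `{· ↔ · in H}`).
-/

noncomputable section
namespace Summit.CriticalPhenomena.CardyFormulaZ2.Cruxes.HalfPlaneMarkDensityLaw.SketchLine.SelfDual
open Literature.Probability.Percolation Literature.Probability.LatticeModels
open Literature.Probability.Percolation.Z2HalfPlane (leg adj_leg)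
open MeasureTheory Filter Set SimpleGraph
open Summit.CriticalPhenomena.CardyFormulaZ2.Theorems.HalfPlaneMarkDensityLaw.Negative

/-- **Deterministic cover of `FewL`.** If `(r,0)`, `1 ≤ r ≤ S`, is joined inside the half-plane `H`
to the ray `(-∞,-X] × {0}` and its `H`-cluster has at most `M` touches of the window
`[-X-W, -X] × {0}`, then either `[1,S] × {0}` is joined in `H` to the far ray `{v₀ < -X-W} × {0}` (F),
or one of the end zones `[-X-W, -X-W+ℓ] × {0}` (E1), `[-X-ℓ, -X] × {0}` (E2) is joined in `H` to
`[1,S] × {0}`, or (B) some window point `(t,0)`, `-X-W+ℓ ≤ t ≤ -X-ℓ`, is joined in `H` to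
`[1,S] × {0}` with all window touches of its `H`-cluster in `[-X-W+ℓ, -X-ℓ]` and at most `M` of them.
[folklore] -/
theorem fewL_cover : ∀ (X S : ℤ) (M W : ℕ) (ℓ : ℤ), {ω : BondConfig (Site 2) | ∃ r : ℤ, 1 ≤ r ∧ r ≤ S ∧ ω ∈ openCrossing halfPlane {v : Site 2 | v 1 = 0 ∧ v 0 ≤ -X} {bpt r} ∧ (∀ r' : ℤ, 1 ≤ r' → r' < r → ω ∉ openCrossing halfPlane {v : Site 2 | v 1 = 0 ∧ v 0 ≤ -X} {bpt r'}) ∧ {a : ℤ | -X - W ≤ a ∧ a ≤ -X ∧ ω ∈ openConnIn halfPlane (bpt r) (bpt a)}.ncard ≤ M} ⊆ openCrossing halfPlane (rowIcc 1 S) {v : Site 2 | v 1 = 0 ∧ v 0 < -X - W} ∪ openCrossing halfPlane (rowIcc (-X - W) (-X - W + ℓ)) (rowIcc 1 S) ∪ openCrossing halfPlane (rowIcc (-X - ℓ) (-X)) (rowIcc 1 S) ∪ {ω : BondConfig (Site 2) | ∃ t : ℤ, -X - W + ℓ ≤ t ∧ t ≤ -X - ℓ ∧ ω ∈ openCrossing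 halfPlane {bpt t} (rowIcc 1 S) ∧ (∀ u : ℤ, -X - W ≤ u → u ≤ -X → ω ∈ openConnIn halfPlane (bpt t) (bpt u) → -X - W + ℓ ≤ u ∧ u ≤ -X - ℓ) ∧ {u : ℤ | -X - W ≤ u ∧ u ≤ -X ∧ ω ∈ openConnIn halfPlane (bpt t) (bpt u)}.ncard ≤ M} := by
  intro X S M W ℓ ω hω
  obtain ⟨r, hr1, hrS, hcross, -, hM⟩ := hω
  obtain ⟨x, ⟨hx1, hx0⟩, y, hy, hxy⟩ := hcross
  rw [mem_singleton_iff] at hy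
  subst hy
  have hr : bpt r ∈ rowIcc 1 S := ⟨rfl, hr1, hrS⟩
  by_cases hfar : x 0 < -X - W
  · -- (F): the arc `[1,S] × {0}` is joined in `H` to the far ray
    refine mem_union_left _ (mem_union_left _ (mem_union_left _ ⟨bpt r, hr, x, ⟨hx1, hfar⟩, ?_⟩))
    rw [openConnIn_comm]; exact hxy
  · -- the witness `x = (a, 0)` is a window touch of the `H`-cluster of `(r, 0)`
    push Not at hfar
    obtain ⟨a, rfl⟩ : ∃ a : ℤ, x = bpt a := ⟨x 0, (site_eq_bpt_iff x (x 0)).2 ⟨hx1, rfl⟩⟩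
    have ha1 : -X - W ≤ a := hfar
    have ha2 : a ≤ -X := hx0
    have hra : ω ∈ openConnIn halfPlane (bpt r) (bpt a) := by rw [openConnIn_comm]; exact hxy
    by_cases hend : ∃ u : ℤ, -X - W ≤ u ∧ u ≤ -X ∧ ω ∈ openConnIn halfPlane (bpt r) (bpt u) ∧
        (u ≤ -X - W + ℓ ∨ -X - ℓ ≤ u)
    · obtain ⟨u, hu1, hu2, hru, hu | hu⟩ := hend
      · -- (E1): a window touch in the far end zone
        refine mem_union_left _ (mem_union_left _ (mem_union_right _
          ⟨bpt u, ⟨rfl, hu1, hu⟩, bpt r, hr, ?_⟩))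
        rw [openConnIn_comm]; exact hru
      · -- (E2): a window touch in the near end zone
        refine mem_union_left _ (mem_union_right _ ⟨bpt u, ⟨rfl, hu, hu2⟩, bpt r, hr, ?_⟩)
        rw [openConnIn_comm]; exact hru
    · -- (B): bulk, with `t := a`
      push Not at hend
      have hiff : ∀ u : ℤ, ω ∈ openConnIn halfPlane (bpt a) (bpt u) ↔
          ω ∈ openConnIn halfPlane (bpt r) (bpt u) := fun u =>
        ⟨fun h => PlanarDuality.openConnIn_trans hra h, fun h => PlanarDuality.openConnIn_trans hxy h⟩
      have hset : {u : ℤ | -X - W ≤ u ∧ u ≤ -X ∧ ω ∈ openConnIn halfPlane (bpt a) (bpt u)} =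
          {u : ℤ | -X - W ≤ u ∧ u ≤ -X ∧ ω ∈ openConnIn halfPlane (bpt r) (bpt u)} := by
        ext u; simp only [mem_setOf_eq, hiff]
      obtain ⟨hal, har⟩ := hend a ha1 ha2 hra
      refine mem_union_right _ ⟨a, hal.le, har.le, ⟨bpt a, rfl, bpt r, hr, hxy⟩,
        fun u hu1 hu2 hau => ?_, ?_⟩
      · obtain ⟨h1, h2⟩ := hend u hu1 hu2 ((hiff u).1 hau)
        exact ⟨h1.le, h2.le⟩
      · rw [hset]; exact hM

end Summit.CriticalPhenomena.CardyFormulaZ2.Cruxes.HalfPlaneMarkDensityLaw.SketchLine.SelfDual
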